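import Summits.AtomisticToContinuum.Crystallization.Theorems.SquareWellLayerCakeGapTwelveToBarlowCombinatorialLayeringTransportSteps2
import Summits.AtomisticToContinuum.Crystallization.Theorems.SquareWellLayerCakeGapTwelveToBarlowCombinatorialLayeringTransportSteps3
import Summits.AtomisticToContinuum.Crystallization.Theorems.SquareWellLayerCakeGapTwelveToBarlowCombinatorialLayeringTransportSteps5
import Summits.AtomisticToContinuum.Crystallization.Theorems.SquareWellLayerCakeGapTwelveToBarlowCombinatorialLayeringTransportSteps6

/-!
# Combinatorial layering (B1a of `GapTwelveToBarlow`): transport port, part `GlobalA`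

Crux `SquareWellLayerCake.GapTwelveToBarlow` (stmt-AtomisticToContinuum-15807), line `Sketch`,
stub `stub_combinatorialLayering`, residual `(H_develop)`.  PORT of the local lemmas `back_I`, `back_J` of the tree file
`PalmUnimodularRigidityShellsToBarlowChartTransportGlobalA.lean` (crux 9227) to GRADED COMBINATORIAL
charts, plus `nbhdFin`, the graded form of its `nbhd` on a finite diamond `|j| + |i| ≤ R` of a
levelled coherent family of frames (the shape `planeFin` of `…TransportFinitePlane` produces),, following the port rules recorded in `…CombinatorialLayeringTransportSteps1` (bundled
standing hypothesis `hch` on `S : ℕ → Set E3`, abstract bond relation `B`, memberships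
`x ∈ S (n + k)`, transfer as an input).  Statements and proofs are otherwise those of the source,
whose documentation follows.

# Line `develop-the-model-growth-descent` (crux `ShellsToBarlowChart`, stmt-AtomisticToContinuum-9227): coherent layers and their `V` / `V⁻¹` images

Helper lemmas for `stub_transportSystem` (the geometric half of the line): frames `⟨x, t₁, t₂, U⟩`
read in the integer charts `IsZChart` of a good-shell configuration, their transports and the
coherence of the resulting development `frameAt`.  The only metric inputs are the chart transfer
lemma and `bond_nb_iff`; everything else is label combinatorics in `ℤ³` (pattern facts
`TransportPatterns*`).  All `[folklore]` (HalesDSP2012 §1.3 for the two kissing patterns).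
-/

noncomputable section

namespace Summit.AtomisticToContinuum.Crystallization.Theorems.SquareWellLayerCakeGapTwelveToBarlow

open Literature.Geometry.DiscreteGeometry Literature.MathematicalPhysics.StatisticalMechanics
open Summit.AtomisticToContinuum.Crystallization.Theorems.PalmUnimodularRigidityShellsToBarlowChart hiding
  IsZChart TransportSystem scales_tied sqNormInt_transfer bond_symm nb_mem zlab_spec zlab_nb
  bond_nb_iff pattern_cases transfer_nb_nb transfer_nb_centre transfer_nb_target
  sqNormInt_zlab_centre hcp_of_mirror_pair Istep_spec Jstep_spec IinvStep_spec JinvStep_spec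
  capWithAny_of_mem_cap IinvStep_Istep Istep_IinvStep JinvStep_Jstep Jstep_JinvStep polar_at_apex
  onesided_at_apex Vstep_spec nb_inj Istep_lower Jstep_lower IinvStep_lower JinvStep_lower
  polar_at_lower_apex onesided_at_lower_apex VinvStep_spec attach_I_even attach_I_odd
  attach_lower_I_pos attach_lower_I_neg attach_J_even attach_J_odd Vstep_Istep_pt Vstep_Istep_back
  Vstep_Istep_side Vstep_Jstep_pt Vstep_Istep_comm Vstep_Jstep_comm attach_lower_J_pos
  attach_lower_J_neg VinvStep_Istep_pt VinvStep_Jstep_pt VinvStep_Istep_back VinvStep_Istep_side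
  VinvStep_Istep_comm VinvStep_Jstep_comm Istep_Jstep_comm

variable {S : ℕ → Set (EuclideanSpace ℝ (Fin 3))}
  {B : EuclideanSpace ℝ (Fin 3) → EuclideanSpace ℝ (Fin 3) → Prop}
  {Pc : EuclideanSpace ℝ (Fin 3) → Finset (Fin 3 → ℤ)}
  {nb : EuclideanSpace ℝ (Fin 3) → (Fin 3 → ℤ) → EuclideanSpace ℝ (Fin 3)}

variable
  (hch : (∀ n : ℕ, ∀ z ∈ S n, (Pc z = fcc3Int ∨ Pc z = hcpInt) ∧
      Set.BijOn (nb z) (↑(Pc z) : Set (Fin 3 → ℤ)) {y | B z y} ∧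
      ∀ t ∈ Pc z, ∀ t' ∈ Pc z, (B (nb z t) (nb z t') ↔ sqNormInt (t - t') = 18)) ∧
    (∀ n : ℕ, ∀ z ∈ S (n + 1), ∀ y, B z y → y ∈ S n) ∧
    (∀ n m : ℕ, ∀ x ∈ S n, ∀ y ∈ S m, B x y →
      ∀ (z z' : EuclideanSpace ℝ (Fin 3)) (t t' u u' : Fin 3 → ℤ),
        (t = 0 ∧ z = x ∨ t ∈ Pc x ∧ z = nb x t) → (t' = 0 ∧ z' = x ∨ t' ∈ Pc x ∧ z' = nb x t') →
        (u = 0 ∧ z = y ∨ u ∈ Pc y ∧ z = nb y u) → (u' = 0 ∧ z' = y ∨ u' ∈ Pc y ∧ z' = nb y u') →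
        sqNormInt (u - u') = sqNormInt (t - t')) ∧
    (∀ x y, B x y → B y x))

include hch


/-- Going back along `I`: if `⟨x, t₁, t₂, U⟩ = I g'` for a valid `g' = ⟨x', a, b, W⟩` then
`I⁻¹ ⟨x, t₁, t₂, U⟩ = g'`, `nb x (−t₁) = x'`, and the I-regime holds at `g'`. [folklore] -/
theorem back_I {n : ℕ} {x x' : (EuclideanSpace ℝ (Fin 3))} {t₁ t₂ a b : Fin 3 → ℤ} {U W : Finset (Fin 3 → ℤ)} (hx' : x' ∈ S (n + 1)) (hW : IsFrame (Pc x') a b W) (hU : IsFrame (Pc x) t₁ t₂ U) (hrel : (⟨x, t₁, t₂, U⟩ : ZFrame) = Istep Pc nb ⟨x', a, b, W⟩) : IinvStep Pc nb ⟨x, t₁, t₂, U⟩ = ⟨x', a, b, W⟩ ∧ nb x (-t₁) = x' ∧ IsFrame (Pc (nb x' a)) (Istep Pc nb ⟨x', a, b, W⟩).t₁ (Istep Pc nb ⟨x', a, b, W⟩).t₂ (Istep Pc nb ⟨x', a, b, W⟩).U := by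
  have hxe : x = (Istep Pc nb ⟨x', a, b, W⟩).pt := congrArg ZFrame.pt hrel
  have ht₁e : t₁ = (Istep Pc nb ⟨x', a, b, W⟩).t₁ := congrArg ZFrame.t₁ hrel
  have ht₂e : t₂ = (Istep Pc nb ⟨x', a, b, W⟩).t₂ := congrArg ZFrame.t₂ hrel
  have hUe : U = (Istep Pc nb ⟨x', a, b, W⟩).U := congrArg ZFrame.U hrel
  have hval : IsFrame (Pc (nb x' a)) (Istep Pc nb ⟨x', a, b, W⟩).t₁ (Istep Pc nb ⟨x', a, b, W⟩).t₂
      (Istep Pc nb ⟨x', a, b, W⟩).U := by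
    rw [hxe, ht₁e, ht₂e, hUe] at hU; exact hU
  have hreg := hregI_of_valid (Pc := Pc) (nb := nb) hval
  obtain ⟨-, -, -, hwx, -⟩ := Istep_spec hch hx' hW hreg
  have hback : nb x (-t₁) = x' := by
    rw [hxe, ht₁e]
    show nb (nb x' a) (-(-zlab Pc nb (nb x' a) x')) = x'
    rw [neg_neg]; exact hwx
  refine ⟨?_, hback, hval⟩
  rw [hrel]; exact IinvStep_Istep hch hx' hW hreg

/-- Going back along `J` (symmetric to `back_I`). [folklore] -/
theorem back_J {n : ℕ} {x x' : (EuclideanSpace ℝ (Fin 3))}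
    {t₁ t₂ a b : Fin 3 → ℤ} {U W : Finset (Fin 3 → ℤ)} (hx' : x' ∈ S (n + 1)) (hW : IsFrame (Pc x') a b W)
    (hU : IsFrame (Pc x) t₁ t₂ U) (hrel : (⟨x, t₁, t₂, U⟩ : ZFrame) = Jstep Pc nb ⟨x', a, b, W⟩) :
    JinvStep Pc nb ⟨x, t₁, t₂, U⟩ = ⟨x', a, b, W⟩ ∧ nb x (-t₂) = x' ∧
      IsFrame (Pc (nb x' b)) (Jstep Pc nb ⟨x', a, b, W⟩).t₁ (Jstep Pc nb ⟨x', a, b, W⟩).t₂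
        (Jstep Pc nb ⟨x', a, b, W⟩).U := by
  have hxe : x = (Jstep Pc nb ⟨x', a, b, W⟩).pt := congrArg ZFrame.pt hrel
  have ht₁e : t₁ = (Jstep Pc nb ⟨x', a, b, W⟩).t₁ := congrArg ZFrame.t₁ hrel
  have ht₂e : t₂ = (Jstep Pc nb ⟨x', a, b, W⟩).t₂ := congrArg ZFrame.t₂ hrel
  have hUe : U = (Jstep Pc nb ⟨x', a, b, W⟩).U := congrArg ZFrame.U hrel
  have hval : IsFrame (Pc (nb x' b)) (Jstep Pc nb ⟨x', a, b, W⟩).t₁ (Jstep Pc nb ⟨x', a, b, W⟩).t₂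
      (Jstep Pc nb ⟨x', a, b, W⟩).U := by
    rw [hxe, ht₁e, ht₂e, hUe] at hU; exact hU
  have hreg := hregJ_of_valid (Pc := Pc) (nb := nb) hval
  obtain ⟨-, -, -, hwx, -⟩ := Jstep_spec hch hx' hW hreg
  have hback : nb x (-t₂) = x' := by
    rw [hxe, ht₂e]
    show nb (nb x' b) (-(-zlab Pc nb (nb x' b) x')) = x'
    rw [neg_neg]; exact hwx
  refine ⟨?_, hback, hval⟩
  rw [hrel]; exact JinvStep_Jstep hch hx' hW hreg

/-- **The neighbourhood of a site of a finite coherent layer** (graded `nbhd`).  In a family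
`Φ : ℤ² → frames` valid, levelled (`(Φ i j).pt ∈ S (L i j + 1)`) and coherent on the diamond
`|j| + |i| ≤ R`, every frame `⟨x, t₁, t₂, U⟩ = Φ i j` with `|j| + |i| + 3 ≤ R` has all the
hypotheses of the commutation theorems: the eight frames around it are valid and the in-layer
commutation holds (margin `3`: the back-diagonal neighbours `Φ (i±1) (j∓1)` and their
transports must stay inside the diamond). [folklore] -/
theorem nbhdFin {R : ℕ} {L : ℤ → ℤ → ℕ} {Φ : ℤ → ℤ → ZFrame}
    (hval : ∀ i j : ℤ, j.natAbs + i.natAbs ≤ R → IsFrame (Pc (Φ i j).pt) (Φ i j).t₁ (Φ i j).t₂ (Φ i j).U)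
    (hS : ∀ i j : ℤ, j.natAbs + i.natAbs ≤ R → (Φ i j).pt ∈ S (L i j + 1))
    (hI : ∀ i j : ℤ, j.natAbs + i.natAbs + 1 ≤ R → Φ (i + 1) j = Istep Pc nb (Φ i j))
    (hJ : ∀ i j : ℤ, j.natAbs + 1 + i.natAbs ≤ R → Φ i (j + 1) = Jstep Pc nb (Φ i j)) (i j : ℤ)
    (hij : j.natAbs + i.natAbs + 3 ≤ R) {x : (EuclideanSpace ℝ (Fin 3))} {t₁ t₂ : Fin 3 → ℤ}
    {U : Finset (Fin 3 → ℤ)} (h : Φ i j = ⟨x, t₁, t₂, U⟩) :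
    x ∈ S (L i j + 1) ∧ IsFrame (Pc x) t₁ t₂ U ∧
    IsFrame (Pc (nb x t₁)) (Istep Pc nb ⟨x, t₁, t₂, U⟩).t₁ (Istep Pc nb ⟨x, t₁, t₂, U⟩).t₂
      (Istep Pc nb ⟨x, t₁, t₂, U⟩).U ∧
    IsFrame (Pc (nb x t₂)) (Jstep Pc nb ⟨x, t₁, t₂, U⟩).t₁ (Jstep Pc nb ⟨x, t₁, t₂, U⟩).t₂
      (Jstep Pc nb ⟨x, t₁, t₂, U⟩).U ∧
    IsFrame (Pc (nb x (-t₁))) (IinvStep Pc nb ⟨x, t₁, t₂, U⟩).t₁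
      (IinvStep Pc nb ⟨x, t₁, t₂, U⟩).t₂ (IinvStep Pc nb ⟨x, t₁, t₂, U⟩).U ∧
    IsFrame (Pc (nb x (-t₂))) (JinvStep Pc nb ⟨x, t₁, t₂, U⟩).t₁
      (JinvStep Pc nb ⟨x, t₁, t₂, U⟩).t₂ (JinvStep Pc nb ⟨x, t₁, t₂, U⟩).U ∧
    IsFrame (Pc (nb (nb x t₁) (Istep Pc nb ⟨x, t₁, t₂, U⟩).t₁))
      (Istep Pc nb (Istep Pc nb ⟨x, t₁, t₂, U⟩)).t₁ (Istep Pc nb (Istep Pc nb ⟨x, t₁, t₂, U⟩)).t₂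
      (Istep Pc nb (Istep Pc nb ⟨x, t₁, t₂, U⟩)).U ∧
    IsFrame (Pc (nb (nb x t₁) (Istep Pc nb ⟨x, t₁, t₂, U⟩).t₂))
      (Jstep Pc nb (Istep Pc nb ⟨x, t₁, t₂, U⟩)).t₁ (Jstep Pc nb (Istep Pc nb ⟨x, t₁, t₂, U⟩)).t₂
      (Jstep Pc nb (Istep Pc nb ⟨x, t₁, t₂, U⟩)).U ∧
    IsFrame (Pc (nb (nb x t₁) (-(Istep Pc nb ⟨x, t₁, t₂, U⟩).t₁)))
      (IinvStep Pc nb (Istep Pc nb ⟨x, t₁, t₂, U⟩)).t₁ (IinvStep Pc nb (Istep Pc nb ⟨x, t₁, t₂, U⟩)).t₂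
      (IinvStep Pc nb (Istep Pc nb ⟨x, t₁, t₂, U⟩)).U ∧
    IsFrame (Pc (nb (nb x t₁) (-(Istep Pc nb ⟨x, t₁, t₂, U⟩).t₂)))
      (JinvStep Pc nb (Istep Pc nb ⟨x, t₁, t₂, U⟩)).t₁ (JinvStep Pc nb (Istep Pc nb ⟨x, t₁, t₂, U⟩)).t₂
      (JinvStep Pc nb (Istep Pc nb ⟨x, t₁, t₂, U⟩)).U ∧
    IsFrame (Pc (nb (nb x t₂) (Jstep Pc nb ⟨x, t₁, t₂, U⟩).t₂))
      (Jstep Pc nb (Jstep Pc nb ⟨x, t₁, t₂, U⟩)).t₁ (Jstep Pc nb (Jstep Pc nb ⟨x, t₁, t₂, U⟩)).t₂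
      (Jstep Pc nb (Jstep Pc nb ⟨x, t₁, t₂, U⟩)).U ∧
    IsFrame (Pc (nb (nb x t₂) (Jstep Pc nb ⟨x, t₁, t₂, U⟩).t₁))
      (Istep Pc nb (Jstep Pc nb ⟨x, t₁, t₂, U⟩)).t₁ (Istep Pc nb (Jstep Pc nb ⟨x, t₁, t₂, U⟩)).t₂
      (Istep Pc nb (Jstep Pc nb ⟨x, t₁, t₂, U⟩)).U ∧
    IsFrame (Pc (nb (nb x t₂) (-(Jstep Pc nb ⟨x, t₁, t₂, U⟩).t₂)))
      (JinvStep Pc nb (Jstep Pc nb ⟨x, t₁, t₂, U⟩)).t₁ (JinvStep Pc nb (Jstep Pc nb ⟨x, t₁, t₂, U⟩)).t₂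
      (JinvStep Pc nb (Jstep Pc nb ⟨x, t₁, t₂, U⟩)).U ∧
    IsFrame (Pc (nb (nb x t₂) (-(Jstep Pc nb ⟨x, t₁, t₂, U⟩).t₁)))
      (IinvStep Pc nb (Jstep Pc nb ⟨x, t₁, t₂, U⟩)).t₁ (IinvStep Pc nb (Jstep Pc nb ⟨x, t₁, t₂, U⟩)).t₂
      (IinvStep Pc nb (Jstep Pc nb ⟨x, t₁, t₂, U⟩)).U ∧
    Istep Pc nb (Jstep Pc nb ⟨x, t₁, t₂, U⟩) = Jstep Pc nb (Istep Pc nb ⟨x, t₁, t₂, U⟩) := by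
  -- validity of any `Φ i' j'` written as an explicit expression
  have hvalE : ∀ (i' j' : ℤ), j'.natAbs + i'.natAbs ≤ R → ∀ (E : ZFrame), Φ i' j' = E →
      IsFrame (Pc E.pt) E.t₁ E.t₂ E.U := by
    intro i' j' hr E hE; rw [← hE]; exact hval i' j' hr
  have hx : x ∈ S (L i j + 1) := by have := hS i j (by omega); rw [h] at this; exact this
  have hU : IsFrame (Pc x) t₁ t₂ U := hvalE i j (by omega) _ h
  -- forward expressions
  have eI : Φ (i + 1) j = Istep Pc nb ⟨x, t₁, t₂, U⟩ := by rw [hI i j (by omega), h]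
  have eJ : Φ i (j + 1) = Jstep Pc nb ⟨x, t₁, t₂, U⟩ := by rw [hJ i j (by omega), h]
  have eII : Φ (i + 1 + 1) j = Istep Pc nb (Istep Pc nb ⟨x, t₁, t₂, U⟩) := by
    rw [hI (i + 1) j (by omega), eI]
  have eJI : Φ (i + 1) (j + 1) = Jstep Pc nb (Istep Pc nb ⟨x, t₁, t₂, U⟩) := by
    rw [hJ (i + 1) j (by omega), eI]
  have eJJ : Φ i (j + 1 + 1) = Jstep Pc nb (Jstep Pc nb ⟨x, t₁, t₂, U⟩) := by
    rw [hJ i (j + 1) (by omega), eJ]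
  have eIJ : Φ (i + 1) (j + 1) = Istep Pc nb (Jstep Pc nb ⟨x, t₁, t₂, U⟩) := by
    rw [hI i (j + 1) (by omega), eJ]
  have hcomm : Istep Pc nb (Jstep Pc nb ⟨x, t₁, t₂, U⟩) = Jstep Pc nb (Istep Pc nb ⟨x, t₁, t₂, U⟩) := by
    rw [← eIJ, ← eJI]
  have hIg := hvalE (i + 1) j (by omega) _ eI
  have hJg := hvalE i (j + 1) (by omega) _ eJ
  have hIIg := hvalE (i + 1 + 1) j (by omega) _ eII
  have hJIg := hvalE (i + 1) (j + 1) (by omega) _ eJI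
  have hJJg := hvalE i (j + 1 + 1) (by omega) _ eJJ
  have hIJg := hvalE (i + 1) (j + 1) (by omega) _ eIJ
  -- backward along I at `(i, j)`: `Φ (i−1) j`
  rcases hm : Φ (i - 1) j with ⟨x', a, b, W⟩
  have hx' : x' ∈ S (L (i - 1) j + 1) := by have := hS (i - 1) j (by omega); rw [hm] at this; exact this
  have hW : IsFrame (Pc x') a b W := hvalE (i - 1) j (by omega) _ hm
  have hrelI : (⟨x, t₁, t₂, U⟩ : ZFrame) = Istep Pc nb ⟨x', a, b, W⟩ := by
    rw [← h, ← hm, ← hI (i - 1) j (by omega), Int.sub_add_cancel]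
  obtain ⟨hIinv, hbackI, -⟩ := back_I hch hx' hW hU hrelI
  -- backward along J at `(i, j)`: `Φ i (j−1)`
  rcases hn : Φ i (j - 1) with ⟨x'', a', b', W'⟩
  have hx'' : x'' ∈ S (L i (j - 1) + 1) := by have := hS i (j - 1) (by omega); rw [hn] at this; exact this
  have hW' : IsFrame (Pc x'') a' b' W' := hvalE i (j - 1) (by omega) _ hn
  have hrelJ : (⟨x, t₁, t₂, U⟩ : ZFrame) = Jstep Pc nb ⟨x'', a', b', W'⟩ := by
    rw [← h, ← hn, ← hJ i (j - 1) (by omega), Int.sub_add_cancel]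
  obtain ⟨hJinv, hbackJ, -⟩ := back_J hch hx'' hW' hU hrelJ
  have hIig : IsFrame (Pc (nb x (-t₁))) (IinvStep Pc nb ⟨x, t₁, t₂, U⟩).t₁
      (IinvStep Pc nb ⟨x, t₁, t₂, U⟩).t₂ (IinvStep Pc nb ⟨x, t₁, t₂, U⟩).U := by
    rw [hIinv, hbackI]; exact hW
  have hJig : IsFrame (Pc (nb x (-t₂))) (JinvStep Pc nb ⟨x, t₁, t₂, U⟩).t₁
      (JinvStep Pc nb ⟨x, t₁, t₂, U⟩).t₂ (JinvStep Pc nb ⟨x, t₁, t₂, U⟩).U := by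
    rw [hJinv, hbackJ]; exact hW'
  -- `I⁻¹ (I g) = g`, `J⁻¹ (J g) = g`
  have hregI := hregI_of_valid (Pc := Pc) (nb := nb) hIg
  have hregJ := hregJ_of_valid (Pc := Pc) (nb := nb) hJg
  obtain ⟨hyS, -, -, hwx, -⟩ := Istep_spec hch hx hU hregI
  obtain ⟨hyJS, -, -, hwxJ, -⟩ := Jstep_spec hch hx hU hregJ
  have hIiIg : IsFrame (Pc (nb (nb x t₁) (-(Istep Pc nb ⟨x, t₁, t₂, U⟩).t₁)))
      (IinvStep Pc nb (Istep Pc nb ⟨x, t₁, t₂, U⟩)).t₁ (IinvStep Pc nb (Istep Pc nb ⟨x, t₁, t₂, U⟩)).t₂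
      (IinvStep Pc nb (Istep Pc nb ⟨x, t₁, t₂, U⟩)).U := by
    rw [IinvStep_Istep hch hx hU hregI]
    have e : nb (nb x t₁) (-(Istep Pc nb ⟨x, t₁, t₂, U⟩).t₁) = x := by
      show nb (nb x t₁) (-(-zlab Pc nb (nb x t₁) x)) = x
      rw [neg_neg]; exact hwx
    rw [e]; exact hU
  have hJiJg : IsFrame (Pc (nb (nb x t₂) (-(Jstep Pc nb ⟨x, t₁, t₂, U⟩).t₂)))
      (JinvStep Pc nb (Jstep Pc nb ⟨x, t₁, t₂, U⟩)).t₁ (JinvStep Pc nb (Jstep Pc nb ⟨x, t₁, t₂, U⟩)).t₂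
      (JinvStep Pc nb (Jstep Pc nb ⟨x, t₁, t₂, U⟩)).U := by
    rw [JinvStep_Jstep hch hx hU hregJ]
    have e : nb (nb x t₂) (-(Jstep Pc nb ⟨x, t₁, t₂, U⟩).t₂) = x := by
      show nb (nb x t₂) (-(-zlab Pc nb (nb x t₂) x)) = x
      rw [neg_neg]; exact hwxJ
    rw [e]; exact hU
  -- `J⁻¹ (I g) = Φ (i+1) (j−1)` and `I⁻¹ (J g) = Φ (i−1) (j+1)`
  rcases hp : Φ (i + 1) (j - 1) with ⟨xp, ap, bp, Wp⟩
  have hxp : xp ∈ S (L (i + 1) (j - 1) + 1) := by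
    have := hS (i + 1) (j - 1) (by omega); rw [hp] at this; exact this
  have hWp : IsFrame (Pc xp) ap bp Wp := hvalE (i + 1) (j - 1) (by omega) _ hp
  rcases hq : Istep Pc nb ⟨x, t₁, t₂, U⟩ with ⟨xq, aq, bq, Wq⟩
  have hrelp : (⟨xq, aq, bq, Wq⟩ : ZFrame) = Jstep Pc nb ⟨xp, ap, bp, Wp⟩ := by
    rw [← hq, ← eI, ← hp, ← hJ (i + 1) (j - 1) (by omega), Int.sub_add_cancel]
  have hUq : IsFrame (Pc xq) aq bq Wq := by
    have := hIg; rw [hq] at this; exact this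
  obtain ⟨hJinvq, hbackq, -⟩ := back_J hch hxp hWp hUq hrelp
  have hJiIg : IsFrame (Pc (nb (nb x t₁) (-(Istep Pc nb ⟨x, t₁, t₂, U⟩).t₂)))
      (JinvStep Pc nb (Istep Pc nb ⟨x, t₁, t₂, U⟩)).t₁ (JinvStep Pc nb (Istep Pc nb ⟨x, t₁, t₂, U⟩)).t₂
      (JinvStep Pc nb (Istep Pc nb ⟨x, t₁, t₂, U⟩)).U := by
    have ex : nb x t₁ = xq := congrArg ZFrame.pt hq
    rw [hq, ex, hJinvq]
    show IsFrame (Pc (nb xq (-bq))) ap bp Wp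
    rw [hbackq]; exact hWp
  rcases hr : Φ (i - 1) (j + 1) with ⟨xr, ar, br, Wr⟩
  have hxr : xr ∈ S (L (i - 1) (j + 1) + 1) := by
    have := hS (i - 1) (j + 1) (by omega); rw [hr] at this; exact this
  have hWr : IsFrame (Pc xr) ar br Wr := hvalE (i - 1) (j + 1) (by omega) _ hr
  rcases hs : Jstep Pc nb ⟨x, t₁, t₂, U⟩ with ⟨xs, as, bs, Ws⟩
  have hrels : (⟨xs, as, bs, Ws⟩ : ZFrame) = Istep Pc nb ⟨xr, ar, br, Wr⟩ := by
    rw [← hs, ← eJ, ← hr, ← hI (i - 1) (j + 1) (by omega), Int.sub_add_cancel]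
  have hUs : IsFrame (Pc xs) as bs Ws := by
    have := hJg; rw [hs] at this; exact this
  obtain ⟨hIinvs, hbacks, -⟩ := back_I hch hxr hWr hUs hrels
  have hIiJg : IsFrame (Pc (nb (nb x t₂) (-(Jstep Pc nb ⟨x, t₁, t₂, U⟩).t₁)))
      (IinvStep Pc nb (Jstep Pc nb ⟨x, t₁, t₂, U⟩)).t₁ (IinvStep Pc nb (Jstep Pc nb ⟨x, t₁, t₂, U⟩)).t₂
      (IinvStep Pc nb (Jstep Pc nb ⟨x, t₁, t₂, U⟩)).U := by
    have ex : nb x t₂ = xs := congrArg ZFrame.pt hs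
    rw [hs, ex, hIinvs]
    show IsFrame (Pc (nb xs (-as))) ar br Wr
    rw [hbacks]; exact hWr
  rw [hq] at hIIg hJIg hIiIg hJiIg hIg hcomm
  rw [hs] at hJJg hIJg hJiJg hIiJg hJg hcomm
  have ex : nb x t₁ = xq := congrArg ZFrame.pt hq
  have es : nb x t₂ = xs := congrArg ZFrame.pt hs
  rw [ex] at hIiIg hJiIg ⊢
  rw [es] at hJiJg hIiJg ⊢
  exact ⟨hx, hU, hIg, hJg, hIig, hJig, hIIg, hJIg, hIiIg, hJiIg, hJJg, hIJg, hJiJg, hIiJg, hcomm⟩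


/-! ## Registered anchor (closed form) -/

omit hch in
/-- **Closed form of `back_I`** (the registered anchor of this file): the section data
`S, B, Pc, nb` and the standing hypothesis written out (two hypotheses regrouped). [folklore] -/
theorem back_I_graded :
    ∀ {S : ℕ → Set (EuclideanSpace ℝ (Fin 3))} {B : EuclideanSpace ℝ (Fin 3) → EuclideanSpace ℝ
    (Fin 3) → Prop} {Pc : EuclideanSpace ℝ (Fin 3) → Finset (Fin 3 → ℤ)} {nb : EuclideanSpace ℝ
    (Fin 3) → (Fin 3 → ℤ) → EuclideanSpace ℝ (Fin 3)}, ((∀ n : ℕ, ∀ z ∈ S n, (Pc z =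
    Summit.AtomisticToContinuum.Crystallization.Theorems.PalmUnimodularRigidityShellsToBarlowChart.fcc3Int
    ∨ Pc z = Literature.Geometry.DiscreteGeometry.hcpInt) ∧ Set.BijOn (nb z) (↑(Pc z) : Set (Fin
    3 → ℤ)) {y | B z y} ∧ ∀ t ∈ Pc z, ∀ t' ∈ Pc z, (B (nb z t) (nb z t') ↔
    Literature.Geometry.DiscreteGeometry.sqNormInt (t - t') = 18)) ∧ (∀ n : ℕ, ∀ z ∈ S (n + 1),
    ∀ y, B z y → y ∈ S n) ∧ (∀ n m : ℕ, ∀ x ∈ S n, ∀ y ∈ S m, B x y → ∀ (z z' : EuclideanSpace ℝ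
    (Fin 3)) (t t' u u' : Fin 3 → ℤ), (t = 0 ∧ z = x ∨ t ∈ Pc x ∧ z = nb x t) → (t' = 0 ∧ z' = x
    ∨ t' ∈ Pc x ∧ z' = nb x t') → (u = 0 ∧ z = y ∨ u ∈ Pc y ∧ z = nb y u) → (u' = 0 ∧ z' = y ∨
    u' ∈ Pc y ∧ z' = nb y u') → Literature.Geometry.DiscreteGeometry.sqNormInt (u - u') =
    Literature.Geometry.DiscreteGeometry.sqNormInt (t - t')) ∧ (∀ x y, B x y → B y x)) → ∀ {n :
    ℕ} {x x' : (EuclideanSpace ℝ (Fin 3))} {t₁ t₂ a b : Fin 3 → ℤ} {U W : Finset (Fin 3 → ℤ)},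
    Summit.AtomisticToContinuum.Crystallization.Theorems.PalmUnimodularRigidityShellsToBarlowChart.IsFrame
    (Pc x') a b W → x' ∈ S (n + 1) →
    Summit.AtomisticToContinuum.Crystallization.Theorems.PalmUnimodularRigidityShellsToBarlowChart.IsFrame
    (Pc x) t₁ t₂ U → (⟨x, t₁, t₂, U⟩ :
    Summit.AtomisticToContinuum.Crystallization.Theorems.PalmUnimodularRigidityShellsToBarlowChart.ZFrame)
    =
    Summit.AtomisticToContinuum.Crystallization.Theorems.PalmUnimodularRigidityShellsToBarlowChart.Istep
    Pc nb ⟨x', a, b, W⟩ →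
    Summit.AtomisticToContinuum.Crystallization.Theorems.PalmUnimodularRigidityShellsToBarlowChart.IinvStep
    Pc nb ⟨x, t₁, t₂, U⟩ = ⟨x', a, b, W⟩ ∧ nb x (-t₁) = x' ∧
    Summit.AtomisticToContinuum.Crystallization.Theorems.PalmUnimodularRigidityShellsToBarlowChart.IsFrame
    (Pc (nb x' a))
    (Summit.AtomisticToContinuum.Crystallization.Theorems.PalmUnimodularRigidityShellsToBarlowChart.Istep
    Pc nb ⟨x', a, b, W⟩).t₁
    (Summit.AtomisticToContinuum.Crystallization.Theorems.PalmUnimodularRigidityShellsToBarlowChart.Istep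
    Pc nb ⟨x', a, b, W⟩).t₂
    (Summit.AtomisticToContinuum.Crystallization.Theorems.PalmUnimodularRigidityShellsToBarlowChart.Istep
    Pc nb ⟨x', a, b, W⟩).U := by
  intro S B Pc nb hch n x x' t₁ t₂ a b U W hW hx' hU hrel
  exact back_I hch hx' hW hU hrel

end Summit.AtomisticToContinuum.Crystallization.Theorems.SquareWellLayerCakeGapTwelveToBarlow

end
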